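import Literature.Computability.QuantumComplexity.PPPostBQPPhi
import Literature.Computability.QuantumComplexity.CWrapFamily
import Literature.Computability.QuantumComplexity.ShallowCircuitsProofs
import Literature.Computability.QuantumComplexity.BQPProofs
import HarnessLib

/-!
# `PP ⊆ PostBQP`, V: the quantum core — layout, circuit family, classical stage

Topic `Literature/Computability/QuantumComplexity`; fifth file of the series proving Aaronson's
`PP ⊆ PostBQP` (Proc. R. Soc. A 461 (2005), Thm. 4; plan in `PPPostBQPScales.lean`). The
**quantum core** `Core.family` is the uniform Clifford+T family which, on input `x` (`n` wires),

1. applies a Hadamard gate to each of the `ρ = K + K·B` coin wires `n … n+ρ-1` (`K = m + 2` sign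
   coins, then `K` bodies of `B = 2m + 5` coins; Aaronson: "first prepare the state
   `2^{-n/2} Σ_x |x⟩|f(x)⟩`" — the uniform superposition over the coins),
2. runs the exact Clifford+T compilation (`revCompile`, `ReversibleCliffordT.lean`) of the
   garbage-free reversible block `RevClean.cleanOps e M (n + ρ) (vg n)` (`RevUncompute.lean`) of a
   polynomial-time machine `M` for the counting function `phiF R p` of file IV, which writes the
   `K` block bits `qbits R p x 0 signs bodies` as the read-out of its output word and restores
   every other work wire,
3. applies a Hadamard gate to each body wire and to each result wire of the first `K` read-out
   cells (Aaronson: "apply Hadamard gates to all qubits in the first register and postselect on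
   that register being `|0…0⟩`" — here the post-selection and the decision are classical
   functions of the measured string, file VII; the Hadamards on the result wires turn the one-hot
   cell codes of the computed bits into the signs `(-1)^{q_j}`).

This file fixes the **layout** (`Core`: sizes `K`, `rho`, `n0`, `nT`, total width `W`, ancilla
count `anc`, the wires as elements of `Fin (n + anc n)`), the **program and circuit**
(`Core.prog`, `Core.clamp`, `Core.circ`, `Core.family`, oracle-freeness), the **Hadamard-layer
bridge** `toMatrix_hGates` (a list of Hadamard gates on distinct wires has the closed-form matrix
`BGK.hLayerMatrix` of `ShallowCircuitsProofs.lean`), and the **classical stage**: the compiled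
block maps the basis label `ins x r` (input `x`, coins `r`, zeros) to the label `sigma x r`
holding `x`, `r` and the read-out of `phiF R p (x ++ r ++ vg n)` (`sigma_apply`, from
`RevClean.clEval_cleanOps`). The amplitudes after the last Hadamard layer are computed in the
sequel (`PPPostBQPCoreAmplitude.lean`).

## References

* S. Aaronson, *Quantum computing, postselection, and probabilistic polynomial-time*, Proc. R.
  Soc. A 461 (2005) 3473–3482, arXiv:quant-ph/0412187: Thm. 4 and its proof.
* C. H. Bennett, *Logical reversibility of computation*, IBM J. Res. Develop. 17 (1973), §2
  (compute–copy–uncompute), as formalised in `RevUncompute.lean`.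
* M. A. Nielsen, I. L. Chuang, *Quantum Computation and Quantum Information*, CUP 2010, §4.2
  (Hadamard layers), §3.2.5.
-/

noncomputable section

namespace Literature.Computability.QuantumComplexity

namespace PPPostBQP

open Complexity Cryptography RevSim RevClean CWrap _root_.Computability Matrix

/-! ### Parameters and layout -/

/-- **Parameters of the quantum core**: a `PP` witness predicate `R` with its coin polynomial
`p`, and a machine `M` computing the counting function `phiF R p` within `(n+2)^e` steps
(`RevClean.exists_outputsWithin_pow_of_mem_FP`). [cite: Aaronson2005, Thm. 4 (proof)] -/
structure Core where
  /-- the witness predicate -/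
  R : Language Bool
  /-- the coin polynomial -/
  p : Polynomial ℕ
  /-- time exponent of the machine -/
  e : ℕ
  /-- the machine of the counting function -/
  M : Turing.TM2ComputableAux Bool Bool
  /-- it computes `phiF R p` within `(n+2)^e` steps -/
  hM : ∀ u : List Bool, M.OutputsWithin u (phiF R p u) (Tn e u.length)

/-- Parameters exist for every `R ∈ P` (the counting function is in `FP`, `phiF_mem_FP`).
[cite: AroraBarak2009, §1.3] -/
theorem exists_core {R : Language Bool} (hR : R ∈ Classes.P) (p : Polynomial ℕ) :
    ∃ Q : Core, Q.R = R ∧ Q.p = p := by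
  obtain ⟨e, M, hM⟩ := exists_outputsWithin_pow_of_mem_FP (phiF_mem_FP (p := p) hR)
  exact ⟨⟨R, p, e, M, hM⟩, rfl, rfl⟩

namespace Core

variable (Q : Core)

/-- Number of blocks `K = m + 2`. [folklore] -/
def K (n : ℕ) : ℕ := Q.p.eval n + 2

/-- Number of body coins of all blocks. [folklore] -/
def bods (n : ℕ) : ℕ := bodiesLen (bodyLen Q.p n) (Q.K n)

/-- Number of coin wires `ρ = K + K·B` (sign coins, then bodies; reducible, so that
`{0,1}^ρ = {0,1}^{K + bods}` splits by `Fin.append`). [folklore] -/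
abbrev rho (n : ℕ) : ℕ := Q.K n + Q.bods n

/-- Number of data wires of the block: input and coins. [folklore] -/
def n0 (n : ℕ) : ℕ := n + Q.rho n

/-- Tableau input length: data and the format suffix `vg n`. [folklore] -/
def nT (n : ℕ) : ℕ := Q.n0 n + (vg n).length

/-- Total number of wires: the width of the clean block. [folklore] -/
def W (n : ℕ) : ℕ := width Q.e Q.M (Q.nT n)

/-- The ancilla count. [folklore] -/
def anc (n : ℕ) : ℕ := Q.W n - n

/-- Start of the result zone: the tableau bound `NN`. [folklore] -/
def resStart (n : ℕ) : ℕ := NN Q.e Q.M (Q.nT n)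

/-- Length of the Hadamard-ed result zone: the `A₁` code wires of each of the first `K` cells. [folklore] -/
def resLen (n : ℕ) : ℕ := Q.K n * A₁ Q.M

/-- `n ≤ n0 ≤ nT ≤ NN ≤ W`. [folklore] -/
theorem n_le_W (n : ℕ) : n ≤ Q.W n := by
  unfold W
  refine le_trans ?_ ((le_NN (e := Q.e) (M := Q.M) _).trans (NN_le_width _))
  unfold nT n0; omega

/-- `n0 ≤ W`. [folklore] -/
theorem n0_le_W (n : ℕ) : Q.n0 n ≤ Q.W n := by
  unfold W
  refine le_trans ?_ ((le_NN (e := Q.e) (M := Q.M) _).trans (NN_le_width _))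
  unfold nT; omega

/-- `n + anc n = W n`. [folklore] -/
theorem n_add_anc (n : ℕ) : n + Q.anc n = Q.W n := by
  unfold anc; have := Q.n_le_W n; omega

/-- The register is nonempty. [folklore] -/
theorem W_pos (n : ℕ) : 0 < n + Q.anc n := by
  rw [n_add_anc]; unfold W
  refine lt_of_lt_of_le ?_ ((le_NN (e := Q.e) (M := Q.M) _).trans (NN_le_width _))
  unfold nT; rw [length_vg]; omega

/-- `nT ≤ resStart`. [folklore] -/
theorem nT_le_resStart (n : ℕ) : Q.nT n ≤ Q.resStart n := le_NN _

/-! ### The program and the circuit -/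

/-- **The reversible program**: the garbage-free block of `M` on the `n + ρ` data wires with
suffix `vg n`. [cite: Shor1997, §3 p.8] -/
def prog (n : ℕ) : List (ClOp ℕ) := cleanOps Q.e Q.M (Q.n0 n) (vg n)

/-- The program is well formed. [folklore] -/
theorem prog_wf (n : ℕ) : ∀ op ∈ Q.prog n, op.WF := cleanOps_wf

/-- The program uses wires below `n + anc n`. [folklore] -/
theorem prog_lt (n : ℕ) : ∀ op ∈ Q.prog n, ∀ i ∈ wiresOf op, i < n + Q.anc n := by
  rw [n_add_anc]; exact cleanOps_lt

/-- The program re-indexed to `Fin (n + anc n)` as reversible operations. [cite: AroraBarak2009, §10.3.7 Lemma 10.10] -/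
def clamp (n : ℕ) : List (RevOp (n + Q.anc n)) :=
  toRevList ((Q.prog n).map (ClOp.map (finOf (n + Q.anc n) (Q.W_pos n)))) fun op hop => by
    simp only [List.mem_map] at hop
    obtain ⟨op, hop, rfl⟩ := hop
    exact wf_map_finOf _ (Q.prog_lt n op hop) (Q.prog_wf n op hop)

/-- Semantics of the clamped program: the `ℕ`-program on the lifted assignment. [folklore] -/
theorem revEval_clamp (n : ℕ) (w : QReg (n + Q.anc n)) (q : Fin (n + Q.anc n)) :
    revEval (Q.clamp n) w q = clEval (Q.prog n) (liftW w) q := by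
  unfold clamp
  rw [revEval_toRevList, clEval_map_finOf_apply _ _ (Q.prog_lt n)]

/-- The wire with `ℕ`-index `i` (reduced into `Fin (n + anc n)`; the identity on valid indices). [folklore] -/
def wire (n i : ℕ) : Fin (n + Q.anc n) := finOf (n + Q.anc n) (Q.W_pos n) i

/-- Value of a valid wire. [folklore] -/
theorem val_wire {n i : ℕ} (hi : i < n + Q.anc n) : (Q.wire n i : ℕ) = i := val_finOf_of_lt _ hi

/-- The coin wires `n, …, n + ρ - 1`. [folklore] -/
def coinWires (n : ℕ) : List (Fin (n + Q.anc n)) := (List.range (Q.rho n)).map fun j => Q.wire n (n + j)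

/-- The body wires `n + K, …, n + ρ - 1`. [folklore] -/
def bodyWires (n : ℕ) : List (Fin (n + Q.anc n)) := (List.range (Q.bods n)).map fun j => Q.wire n (n + Q.K n + j)

/-- The result zone `resStart, …, resStart + K·A₁ - 1` (all code wires of the first `K` cells). [folklore] -/
def resWires (n : ℕ) : List (Fin (n + Q.anc n)) := (List.range (Q.resLen n)).map fun j => Q.wire n (Q.resStart n + j)

/-- The wires of the final Hadamard layer. [folklore] -/
def h2Wires (n : ℕ) : List (Fin (n + Q.anc n)) := Q.bodyWires n ++ Q.resWires n

/-- Hadamard gates on a list of wires. [folklore] -/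
def hGates {N : ℕ} (ws : List (Fin N)) : List (QGate cliffordT N) := ws.map hOn

/-- **The circuit of the quantum core** on input length `n`. [cite: Aaronson2005, Thm. 4 (proof)] -/
def circ (n : ℕ) : QCircuit cliffordT (n + Q.anc n) :=
  ⟨hGates (Q.coinWires n) ++ (revCompile (Q.clamp n) ++ hGates (Q.h2Wires n))⟩

/-- **The quantum core family** (reducible: its fields are `anc` and `circ` on the nose).
[cite: Aaronson2005, Thm. 4 (proof)] -/
abbrev family : QCircuitFamily cliffordT := ⟨Q.anc, Q.circ⟩

/-- Hadamard gates are oracle-free. [folklore] -/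
theorem hGates_isOracleFree {N : ℕ} (ws : List (Fin N)) : ∀ g ∈ hGates ws, g.IsOracleFree := by
  intro g hg
  simp only [hGates, List.mem_map] at hg
  obtain ⟨i, -, rfl⟩ := hg
  trivial

/-- **The family is oracle-free.** [folklore] -/
theorem circ_isOracleFree (n : ℕ) : (Q.circ n).IsOracleFree := by
  intro g hg
  unfold circ at hg
  rcases List.mem_append.1 hg with h | h
  · exact hGates_isOracleFree _ g h
  · rcases List.mem_append.1 h with h | h
    · exact revCompile_isOracleFree _ g h
    · exact hGates_isOracleFree _ g h

/-- **The family is oracle-free.** [folklore] -/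
theorem family_isOracleFree : Q.family.IsOracleFree := fun n => Q.circ_isOracleFree n

/-! ### Bounds on the layout -/

/-- Coin wires fit. [folklore] -/
theorem coin_lt {n j : ℕ} (hj : j < Q.rho n) : n + j < n + Q.anc n := by
  rw [n_add_anc]; unfold W
  refine lt_of_lt_of_le ?_ ((le_NN (e := Q.e) (M := Q.M) _).trans (NN_le_width _))
  unfold nT n0; omega

/-- The result zone fits: `resStart + K·A₁ ≤ W` (needs `K < JJ`, from the length of the output
word of the machine). [folklore] -/
theorem resStart_add_resLen_le (n : ℕ) : Q.resStart n + Q.resLen n ≤ Q.W n := by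
  have hK : Q.K n < JJ Q.e Q.M (Q.nT n) := by
    set u : List Bool := List.replicate n false ++ List.replicate (Q.rho n) false ++ vg (List.replicate n false).length
      with hu
    have hul : u.length = Q.nT n := by
      simp only [hu, List.length_append, List.length_replicate, length_vg, nT, n0]
    have hM := Q.hM u
    rw [hul] at hM
    have h := (length_lt_JJ_of_outputsWithin (e := Q.e) hul hM).1
    rwa [hu, length_phiF_apply _ _ (by simp [rho, K, bods]), List.length_replicate] at h
  unfold resStart resLen W width copyN
  have := Nat.mul_le_mul_right (A₁ Q.M) hK.le
  omega

/-- Result-zone wires fit. [folklore] -/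
theorem res_lt {n j : ℕ} (hj : j < Q.resLen n) : Q.resStart n + j < n + Q.anc n := by
  rw [n_add_anc]; have := Q.resStart_add_resLen_le n; omega

/-- The coin wires are pairwise distinct. [folklore] -/
theorem coinWires_nodup (n : ℕ) : (Q.coinWires n).Nodup := by
  refine (List.nodup_range.map_on ?_)
  intro a ha b hb h
  have h' := congrArg Fin.val h
  rw [Q.val_wire (Q.coin_lt (List.mem_range.1 ha)), Q.val_wire (Q.coin_lt (List.mem_range.1 hb))] at h'
  omega

/-- The wires of the final layer are pairwise distinct. [folklore] -/
theorem h2Wires_nodup (n : ℕ) : (Q.h2Wires n).Nodup := by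
  have hb : ∀ j, j < Q.bods n → n + Q.K n + j < n + Q.anc n := fun j hj => by
    have := Q.coin_lt (n := n) (j := Q.K n + j) (by unfold rho; omega); omega
  refine List.Nodup.append ?_ ?_ ?_
  · refine List.nodup_range.map_on fun a ha b hb' h => ?_
    have h' := congrArg Fin.val h
    rw [Q.val_wire (hb a (List.mem_range.1 ha)), Q.val_wire (hb b (List.mem_range.1 hb'))] at h'
    omega
  · refine List.nodup_range.map_on fun a ha b hb' h => ?_
    have h' := congrArg Fin.val h
    rw [Q.val_wire (Q.res_lt (List.mem_range.1 ha)), Q.val_wire (Q.res_lt (List.mem_range.1 hb'))] at h'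
    omega
  · intro w hw hw'
    simp only [bodyWires, resWires, List.mem_map, List.mem_range] at hw hw'
    obtain ⟨a, ha, rfl⟩ := hw
    obtain ⟨b, hb', h⟩ := hw'
    have h' := congrArg Fin.val h
    rw [Q.val_wire (Q.res_lt hb'), Q.val_wire (hb a ha)] at h'
    have h1 : n + Q.rho n ≤ Q.resStart n := by
      have := Q.nT_le_resStart n; unfold nT n0 at this; omega
    unfold rho at h1; omega

/-! ### Hadamard layers as closed-form matrices -/

/-- **A list of Hadamard gates on distinct wires has the matrix `hLayerMatrix` of the set of its
wires.** [cite: NielsenChuang2010, §4.2] -/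
theorem toMatrix_hGates {N : ℕ} (A : Language Bool) : ∀ (ws : List (Fin N)), ws.Nodup →
    (⟨hGates ws⟩ : QCircuit cliffordT N).toMatrix A = BGK.hLayerMatrix ws.toFinset
  | [], _ => by simp [hGates, BGK.hLayerMatrix_empty]
  | w :: ws, h => by
    have hw : w ∉ ws := (List.nodup_cons.1 h).1
    rw [hGates, List.map_cons, QCircuit.toMatrix_cons, ← hGates, toMatrix_hGates A ws (List.nodup_cons.1 h).2,
      hOn_toMatrix, BGK.hLayerMatrix_mul_placeGate_hGate _ _ (by simpa using hw), List.toFinset_cons]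

/-! ### The classical stage -/

section Classical

variable {Q}
variable (x : List Bool)

/-- The basis label with input `x`, coins `r` and zeros elsewhere. [folklore] -/
def ins (r : Fin (Q.rho x.length) → Bool) : QReg (x.length + Q.anc x.length) := fun q =>
  if h : (q : ℕ) < x.length then x.get ⟨q, h⟩
  else if h' : (q : ℕ) < x.length + Q.rho x.length then r ⟨q - x.length, by omega⟩ else false

/-- `ins x r`, extended to `ℕ`, is the string `x ++ r` followed by zeros. [folklore] -/
theorem liftW_ins (r : Fin (Q.rho x.length) → Bool) : liftW (ins x r) = strW (x ++ List.ofFn r) := by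
  funext i
  unfold liftW strW ins
  by_cases hi : i < x.length + Q.anc x.length
  · rw [dif_pos hi]
    simp only
    by_cases hix : i < x.length
    · rw [dif_pos hix, List.getD_append _ _ _ _ hix, List.getD_eq_getElem _ _ hix]; rfl
    · rw [dif_neg hix]
      by_cases hir : i < x.length + Q.rho x.length
      · rw [dif_pos hir, List.getD_append_right _ _ _ _ (Nat.not_lt.1 hix),
          List.getD_eq_getElem _ _ (by simp; omega), List.getElem_ofFn]
      · rw [dif_neg hir, List.getD_eq_default _ _ (by simp; omega)]
  · have h1 := Q.n0_le_W x.length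
    rw [← Q.n_add_anc] at h1
    unfold n0 at h1
    rw [dif_neg hi, List.getD_eq_default _ _ (by simp; omega)]

/-- **The label after the compiled block** on `ins x r`. [folklore] -/
def sigma (r : Fin (Q.rho x.length) → Bool) : QReg (x.length + Q.anc x.length) := revEval (Q.clamp x.length) (ins x r)

/-- The output word of the machine on the block input with coins `r`. [folklore] -/
def outWord (r : Fin (Q.rho x.length) → Bool) : List Bool := phiF Q.R Q.p (x ++ List.ofFn r ++ vg x.length)

/-- The output word is the vector of block bits. [cite: Aaronson2005, Thm. 4 (proof)] -/
theorem outWord_eq (r : Fin (Q.rho x.length) → Bool) :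
    outWord x r = qbits Q.R Q.p x 0 ((List.ofFn r).take (Q.K x.length)) ((List.ofFn r).drop (Q.K x.length)) :=
  phiF_apply x _ (by simp [rho, K, bods])

/-- The output word has length `K`. [folklore] -/
theorem length_outWord (r : Fin (Q.rho x.length) → Bool) : (outWord x r).length = Q.K x.length :=
  length_phiF_apply x _ (by simp [rho, K, bods])

/-- The machine halts with the output word within the time bound, on the tableau input. [folklore] -/
theorem hM_outWord (r : Fin (Q.rho x.length) → Bool) :
    Q.M.OutputsWithin ((x ++ List.ofFn r) ++ vg x.length) (outWord x r) (Tn Q.e ((x ++ List.ofFn r).length + (vg x.length).length)) := by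
  have h := Q.hM ((x ++ List.ofFn r) ++ vg x.length)
  rwa [List.length_append] at h

/-- **Semantics of the classical stage**: data wires keep `x ++ r`, the other wires hold the
read-out of the output word. [cite: Shor1997, §3 p.8 (compute F(x) keeping x, copy, undo)] -/
theorem sigma_apply (r : Fin (Q.rho x.length) → Bool) (q : Fin (x.length + Q.anc x.length)) :
    sigma x r q = if (q : ℕ) < Q.n0 x.length then (x ++ List.ofFn r).getD q false
      else readOut Q.e Q.M (Q.nT x.length) (outWord x r) q := by
  unfold sigma
  rw [revEval_clamp, liftW_ins]
  have h := clEval_cleanOps (e := Q.e) (M := Q.M) (x ++ List.ofFn r) (vg x.length) (outWord x r) (hM_outWord x r)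
  have hlen : (x ++ List.ofFn r).length = Q.n0 x.length := by simp [n0]
  rw [hlen] at h
  unfold prog
  rw [h]
  rfl

/-- Below the data the label reads the data. [folklore] -/
theorem sigma_apply_of_lt (r : Fin (Q.rho x.length) → Bool) {q : Fin (x.length + Q.anc x.length)}
    (hq : (q : ℕ) < Q.n0 x.length) : sigma x r q = (x ++ List.ofFn r).getD q false := by
  rw [sigma_apply, if_pos hq]

/-- On the data wires the compiled block is the identity: `sigma x r` agrees with `ins x r` below `n0`. [folklore] -/
theorem sigma_apply_eq_ins (r : Fin (Q.rho x.length) → Bool) {q : Fin (x.length + Q.anc x.length)}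
    (hq : (q : ℕ) < Q.n0 x.length) : sigma x r q = ins x r q := by
  rw [sigma_apply_of_lt x r hq, ← liftW_val (ins x r) q, liftW_ins]
  rfl

/-- A `true`-code result wire of a cell `j < K` reads the block bit `q_j`. [folklore] -/
theorem sigma_resW_symTrue (r : Fin (Q.rho x.length) → Bool) {j : ℕ} (hj : j < Q.K x.length)
    (q : Fin (x.length + Q.anc x.length)) (hq : (q : ℕ) = resW Q.e Q.M (Q.nT x.length) j (symTrue Q.M)) :
    sigma x r q = (outWord x r)[j]'(by rw [length_outWord]; exact hj) := by
  have hJ : j < JJ Q.e Q.M (Q.nT x.length) :=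
    lt_of_lt_of_le hj (by
      have hul : ((x ++ List.ofFn r) ++ vg x.length).length = Q.nT x.length := by
        simp only [List.length_append, List.length_ofFn, length_vg, nT, n0]
      have hM := Q.hM ((x ++ List.ofFn r) ++ vg x.length)
      rw [hul] at hM
      have := (length_lt_JJ_of_outputsWithin (e := Q.e) hul hM).1
      rw [show phiF Q.R Q.p (x ++ List.ofFn r ++ vg x.length) = outWord x r from rfl, length_outWord] at this
      exact this.le)
  have hul : ((x ++ List.ofFn r) ++ vg x.length).length = Q.nT x.length := by
    simp only [List.length_append, List.length_ofFn, length_vg, nT, n0]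
  have hM := Q.hM ((x ++ List.ofFn r) ++ vg x.length)
  rw [hul] at hM
  have hge : ¬ (q : ℕ) < Q.n0 x.length := by
    rw [hq]
    have h1 : Q.nT x.length ≤ Q.resStart x.length := Q.nT_le_resStart x.length
    have h2 := NN_le_resW (e := Q.e) (M := Q.M) (Q.nT x.length) j (symTrue Q.M)
    have h3 : Q.n0 x.length ≤ Q.nT x.length := Nat.le_add_right _ _
    unfold resStart at h1
    omega
  rw [sigma_apply, if_neg hge, hq, readOut_resW hJ]
  exact outBit_symTrue_eq (e := Q.e) hul hM _

end Classical

end Core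

end PPPostBQP

end Literature.Computability.QuantumComplexity

end
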